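import Summits.QuantumFields.BalabanUV.T4Continuum.Support.SubstrateDrivenTower
import Literature.MathematicalPhysics.QuantumFieldTheory.Balaban1983to89.T4EtaRateMin

/-!
# SUBSTRATE — NODE U1b's READINGS OF RECORD on the cutoff tower: the minimal actions `A_K(V) = A(U^{(K)}_K(V))` of the driven runs as a
# `T4EtaRateMin.Readings` datum (V1), NE3's consumer shapes `ActionRate ∕ LocalRate` unfolded ON THE OBJECT, and the ACTION SANDWICH
# «`|A_{K+1}(V) − A_K(V)| ≤ max(transport deficit, refinement slack)`» with its two inputs DISPLAYED (follower of `SubstrateDrivenTower`)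

Cell `pub-balaban`, SUBSTRATE cell, seat `b2b-balaban-substrate-p1` («instances first»).  Summits-side under the LEAN PLACEMENT RULE.
HONEST FRAMING: rung (B)+1 of the FINITE-VOLUME T⁴ programme — NOT infinite volume, NOT a mass gap, NOT Clay; spine PROVED 0∕9.  NO
ESTIMATE: node U1b ∕ NE3 («η-rate of the minimisers») is row t4-ne3's and is NOT PRINTED for Bałaban's backgrounds; this file only PLACES
its consumer shapes on the tower of record and proves the order-theoretic sandwich from the minimality fields of `Setup.IsBackground` — the V1
twin of the NE3 crew's V3 sandwich (`MinimalActionLevels` … `MinimalActionRate`, [dict] item S-VOC-2 of `substrate/SUBSTRATE-MAP.md` will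
identify the two).  Nothing of the audited papers is asserted.
HONEST DEPENDENCY (cell line, verbatim): continuum YM on T⁴ ⇐ BetaPertH ∧ nine spine estimates (0/9 proved); BetaPertH ⇐ (D1) ∧ (D4) ∧
CAP+tail; G-an2-4 gates asym, D1 and NE2/3/4.

WHAT.
* §1 `minActOfRecord T K V := wilsonAction4 ((T.bg K).U K (atTop K V))` — the Wilson action of run `K`'s background driven by the unit
  field `V` ([Balaban1987RG1] (0.21) p. 256 `A(U_k(V))`, the TYPE; minimality is the `IsBackground` field on `T.domV`); `= A((T.pair K).uA V)`.
* §2 THE READINGS OF RECORD `readings T loc vol : T4EtaRateMin.Readings (UnitField T.F G) X` (dom := the ONE driving class `T.domV`, act :=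
  `minActOfRecord`, the local reading `loc` and the volume factor CALLER-SUPPLIED exactly as in NE3's `minActReadings`); `actionRate_iff`,
  `localRate_iff` (NE3's shapes ON THE OBJECT, by `Iff.rfl`).
* §3 THE SANDWICH.  Upper half KERNEL: `minAct_le_action_transport` (`A_K(V) ≤ A(transport U^{(K+1)}_{K+1}(V))` — the transported finer
  minimiser is a competitor, `DrivenTower.action_le_transport_all`) hence `minAct_sub_succ_le_deficit`: `A_K(V) − A_{K+1}(V) ≤ transportDeficit
  T K V` (:= `A(transport U_{K+1}) − A(U_{K+1})`, the one-step AVERAGING DEFICIT of run `K+1`'s minimiser — row NE3-R2's β-wall quantity in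
  V1 words); lower half from the DISPLAYED refinement shape `RefineBound T r` (NE3's leaf A-H2 analogue: a competitor on run `K+1`'s
  constraint surface over `V` with action `≤ A_K(V) + r_K`) — `minAct_succ_le_of_refine`; together `abs_sub_le_of_deficit_refine` and
  **`actionRate_of_deficit_refine`**: `ActionRate (readings T loc vol) C θ` from a deficit rate and a refinement rate `≤ C θ^K vol`.
Imports `SubstrateDrivenTower` (p218619) + `T4EtaRateMin`; nothing existing is modified.
-/

noncomputable section

namespace Summit.QuantumFields.BalabanUV.T4Continuum.SubstrateTowerReadings

open Literature.MathematicalPhysics.QuantumFieldTheory.Balaban1983to89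
open Literature.MathematicalPhysics.QuantumFieldTheory.Balaban1983to89.T4EtaRateMin (Readings ActionRate LocalRate)
open Summit.QuantumFields.BalabanUV.T4Continuum.B13Carriers (TwoRuns transportRaw)
open Summit.QuantumFields.BalabanUV.T4Continuum.SubstrateTwoRunsDriven
open Summit.QuantumFields.BalabanUV.T4Continuum.SubstrateDrivenTower

variable {G : Type} [GaugeGroup G] (T : DrivenTower G)

/-! ## §1 The minimal actions of record -/

/-- [folklore] **`A_K(V)`** — the Wilson action of run `K`'s background driven by the unit-lattice field `V` (meaningful on the driving class
`T.domV`, where the background is a constrained minimiser by `IsBackground`; elsewhere the `Background` datum's junk value). -/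
def minActOfRecord (K : ℕ) (V : UnitField T.F G) : ℝ := wilsonAction4 ((T.bg K).U K (atTop K V))

/-- [folklore] On the driving class, `A_K(V)` is the action of the pair-`K` run-A background `uA V`. -/
theorem minActOfRecord_eq_uA (K : ℕ) (V : T.domV) : minActOfRecord T K V.1 = wilsonAction4 ((T.pair K).uA V).1 := rfl

/-- [folklore] … and `A_{K+1}(V)` is the action of the pair-`K` run-B background `uB V`. -/
theorem minActOfRecord_succ_eq_uB (K : ℕ) (V : T.domV) : minActOfRecord T (K + 1) V.1 = wilsonAction4 ((T.pair K).uB V).1 := rfl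

/-- [folklore] MINIMALITY: every regular run-`K` configuration on the constraint surface over `V ∈ domV` has action `≥ A_K(V)`. -/
theorem minActOfRecord_le (K : ℕ) (V : T.domV) (U : GaugeField (T.F.P K) 0 G) (hreg : U ∈ (T.bg K).reg)
    (hc : Averaging.iter (T.av K) K U = atTop K V.1) : minActOfRecord T K V.1 ≤ wilsonAction4 U :=
  (T.pair K).action_uA_le V U hreg hc

/-- [folklore] The actions of record are nonnegative (`wilsonAction4_nonneg`). -/
theorem minActOfRecord_nonneg (K : ℕ) (V : UnitField T.F G) : 0 ≤ minActOfRecord T K V := wilsonAction4_nonneg _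

/-! ## §2 The readings of record and NE3's shapes on them -/

/-- [folklore] **THE READINGS OF RECORD** of node U1b on the cutoff tower: the admissible data are the ONE driving class, the scalar reading of
the `K`-step run is `A_K(V)`; the local reading `loc` (a gauge-invariant local functional of the background near a unit-scale site) and
the volume factor are CALLER-SUPPLIED, as in the NE3 crew's `minActReadings`. -/
def readings (X : Type*) (loc : ℕ → UnitField T.F G → X → ℝ) (vol : ℝ) (hvol : 0 ≤ vol) : Readings (UnitField T.F G) X where
  dom := T.domV
  act := minActOfRecord T
  loc := loc
  vol := vol
  vol_nonneg := hvol

variable {X : Type*} (loc : ℕ → UnitField T.F G → X → ℝ) {vol : ℝ} (hvol : 0 ≤ vol)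

/-- [folklore] NE3's ACTION-RATE SHAPE ON THE OBJECT: `ActionRate (readings T …) C θ ↔ ∀ K, ∀ V ∈ domV, |A_{K+1}(V) − A_K(V)| ≤ C θ^K vol`. -/
theorem actionRate_iff (C θ : ℝ) :
    ActionRate (readings T X loc vol hvol) C θ ↔
      ∀ K : ℕ, ∀ V ∈ T.domV, |minActOfRecord T (K + 1) V - minActOfRecord T K V| ≤ C * θ ^ K * vol :=
  Iff.rfl

/-- [folklore] NE3's LOCAL-RATE SHAPE ON THE OBJECT (the caller's local reading). -/
theorem localRate_iff (C θ : ℝ) :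
    LocalRate (readings T X loc vol hvol) C θ ↔ ∀ K : ℕ, ∀ V ∈ T.domV, ∀ x : X, |loc (K + 1) V x - loc K V x| ≤ C * θ ^ K :=
  Iff.rfl

/-! ## §3 The action sandwich on the tower of record -/

/-- [folklore] **THE TRANSPORT DEFICIT** of run `K+1`'s background at `V`: the action GAINED by one block averaging + level identification,
`A(transport U^{(K+1)}_{K+1}(V)) − A(U^{(K+1)}_{K+1}(V))` (row NE3-R2's averaging-deficit quantity, in V1 words). -/
def transportDeficit (K : ℕ) (V : UnitField T.F G) : ℝ :=
  wilsonAction4 (transportRaw T.F K (T.av (K + 1) 0) ((T.bg (K + 1)).U (K + 1) (atTop (K + 1) V))) -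
    wilsonAction4 ((T.bg (K + 1)).U (K + 1) (atTop (K + 1) V))

/-- [folklore] UPPER HALF, KERNEL: if each one-step transport maps run `K+1`'s regularity class into run `K`'s, then
`A_K(V) ≤ A(transport U^{(K+1)}_{K+1}(V))` (the transported finer minimiser is a competitor — `DrivenTower.action_le_transport_all`). -/
theorem minAct_le_action_transport (hreg : ∀ K, Set.MapsTo (transportRaw T.F K (T.av (K + 1) 0)) (T.bg (K + 1)).reg (T.bg K).reg)
    (K : ℕ) (V : T.domV) :
    minActOfRecord T K V.1 ≤ wilsonAction4 (transportRaw T.F K (T.av (K + 1) 0) ((T.bg (K + 1)).U (K + 1) (atTop (K + 1) V.1))) :=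
  T.action_le_transport_all hreg K V

/-- [folklore] Hence `A_K(V) − A_{K+1}(V) ≤ transportDeficit T K V`. -/
theorem minAct_sub_succ_le_deficit (hreg : ∀ K, Set.MapsTo (transportRaw T.F K (T.av (K + 1) 0)) (T.bg (K + 1)).reg (T.bg K).reg)
    (K : ℕ) (V : T.domV) : minActOfRecord T K V.1 - minActOfRecord T (K + 1) V.1 ≤ transportDeficit T K V.1 := by
  have h := minAct_le_action_transport T hreg K V
  unfold transportDeficit minActOfRecord at *
  linarith

/-- [folklore] THE REFINEMENT SHAPE (DISPLAYED; NE3's leaf A-H2 analogue in V1): for every cutoff and driving field there is a regular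
run-`(K+1)` configuration on the constraint surface over `V` whose action exceeds `A_K(V)` by at most `r K` (in print nowhere; the NE3
crew's `SmoothRefine` is its V3 form). -/
def RefineBound (r : ℕ → ℝ) : Prop :=
  ∀ K : ℕ, ∀ V ∈ T.domV, ∃ W ∈ (T.bg (K + 1)).reg,
    Averaging.iter (T.av (K + 1)) (K + 1) W = atTop (K + 1) V ∧ wilsonAction4 W ≤ minActOfRecord T K V + r K

variable {T} in
/-- [folklore] LOWER HALF from the refinement shape: `A_{K+1}(V) ≤ A_K(V) + r_K` (minimality of `U^{(K+1)}_{K+1}(V)` against the competitor). -/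
theorem minAct_succ_le_of_refine {r : ℕ → ℝ} (h : RefineBound T r) (K : ℕ) (V : T.domV) :
    minActOfRecord T (K + 1) V.1 ≤ minActOfRecord T K V.1 + r K := by
  obtain ⟨W, hW, hc, hA⟩ := h K V.1 V.2
  exact (minActOfRecord_le T (K + 1) V W hW hc).trans hA

variable {T} in
/-- [folklore] **THE SANDWICH**: `|A_{K+1}(V) − A_K(V)| ≤ max (transportDeficit T K V) (r K)`. -/
theorem abs_sub_le_of_deficit_refine
    (hreg : ∀ K, Set.MapsTo (transportRaw T.F K (T.av (K + 1) 0)) (T.bg (K + 1)).reg (T.bg K).reg) {r : ℕ → ℝ} (h : RefineBound T r)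
    (K : ℕ) (V : T.domV) :
    |minActOfRecord T (K + 1) V.1 - minActOfRecord T K V.1| ≤ max (transportDeficit T K V.1) (r K) := by
  rw [abs_sub_le_iff]
  constructor
  · have h1 := minAct_succ_le_of_refine h K V
    exact le_trans (by linarith) (le_max_right _ _)
  · exact le_trans (minAct_sub_succ_le_deficit T hreg K V) (le_max_left _ _)

variable {T} in
/-- [folklore] **NE3's ACTION-RATE SHAPE ON THE TOWER OF RECORD FROM ITS TWO INPUTS** (both DISPLAYED; neither is printed for Bałaban's
minimisers): a transport-deficit rate `transportDeficit T K V ≤ C θ^K vol` and a refinement rate `r K ≤ C θ^K vol` give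
`ActionRate (readings T loc vol) C θ`. -/
theorem actionRate_of_deficit_refine
    (hreg : ∀ K, Set.MapsTo (transportRaw T.F K (T.av (K + 1) 0)) (T.bg (K + 1)).reg (T.bg K).reg) {C θ : ℝ} {r : ℕ → ℝ}
    (hdef : ∀ K : ℕ, ∀ V ∈ T.domV, transportDeficit T K V ≤ C * θ ^ K * vol) (href : RefineBound T r) (hr : ∀ K, r K ≤ C * θ ^ K * vol) :
    ActionRate (readings T X loc vol hvol) C θ := by
  rw [actionRate_iff]
  intro K V hV
  exact (abs_sub_le_of_deficit_refine hreg href K ⟨V, hV⟩).trans (max_le (hdef K V hV) (hr K))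

variable {T} in
/-- [folklore] … and then the limit of the actions of record exists for every driving field, with the geometric tail bound, for an honest
rate `θ < 1` (`T4EtaRateMin.ActionRate.exists_limit` BY NAME, through the readings with the trivial local slot). -/
theorem exists_limit_minAct
    (hreg : ∀ K, Set.MapsTo (transportRaw T.F K (T.av (K + 1) 0)) (T.bg (K + 1)).reg (T.bg K).reg) {C θ : ℝ} {r : ℕ → ℝ}
    (hdef : ∀ K : ℕ, ∀ V ∈ T.domV, transportDeficit T K V ≤ C * θ ^ K * vol) (href : RefineBound T r) (hr : ∀ K, r K ≤ C * θ ^ K * vol)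
    (hvol' : 0 ≤ vol) (hθ : θ < 1) {V : UnitField T.F G} (hV : V ∈ T.domV) :
    ∃ A : ℝ, Filter.Tendsto (fun K => minActOfRecord T K V) Filter.atTop (nhds A) ∧
      ∀ K : ℕ, |minActOfRecord T K V - A| ≤ C * vol * θ ^ K / (1 - θ) :=
  (actionRate_of_deficit_refine (X := Unit) (fun _ _ _ => 0) hvol' hreg hdef href hr).exists_limit hθ hV

end Summit.QuantumFields.BalabanUV.T4Continuum.SubstrateTowerReadings

end
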